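import Summits.NavierStokesRegularity.OSWSelfSimilar.SheetRSpectrumPointCertificateA
import Summits.NavierStokesRegularity.OSWSelfSimilar.SheetRSpectrumPointAssembly
import Summits.NavierStokesRegularity.OSWSelfSimilar.SheetRResolventConj
import Summits.NavierStokesRegularity.OSWSelfSimilar.SheetRSpectrumOddAssembly
import Summits.NavierStokesRegularity.OSWSelfSimilar.SheetRLinearisationPerturbation
import Summits.NavierStokesRegularity.OSWSelfSimilar.SheetREvansEnclosure
import Summits.NavierStokesRegularity.OSWSelfSimilar.CertificateViscousSheetRSpectrum
import HarnessLib

/-!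
# Sheet-ℝ spectral certificate (Z3-SR-SPEC, S2): the sheet assembly keyed on IMPLEMENTATION 1's point balls (`PointDataA`) —
# `RectLabelCertificate E*` with the contour proper in the second arithmetic

HONEST FRAMING (cell ns-blowup GROUP B «PROFILE SEARCH»; PROFILE-SPEC v1.3 case Z3-SR-SPEC; 1-D MODEL (viscous gCLM/OSW sheet on `ℝ` at
`(a, c_l, ε) = (1/5, 1/2, 1)`); computer-assisted; not Euler/NS; «violates: none — MODEL»; census hook
`Literature.Analysis.FluidPDE.effectiveViscosity_half`). Nothing here is a statement about Navier–Stokes, and NO enclosure is proved here.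
WHAT IT DOES (seat ns-blowup-profile-cert-2 g8): `sheet_certificate_of_pointDataA` = `SheetRSpectrumPointAssembly.sheet_certificate_of_pointData` with the
point-record hypothesis `PointData` (implementation 2, kit j270205) replaced by `SheetRSpectrumPointCertificateA.PointDataA` (implementation 1's Arb point
balls, kit j266033/j266404/j266405) — the 42 left-edge pieces of `RectLabelCertificate E*` then rest on implementation 1's arithmetic, the three far edges on
the MIXED far record (implementation 2; the only far record fitting the 12-rectangle). Pure composition (hsym from `SheetRResolventConj`, (P8) allowance from
cert-5's `norm_inner_resolventKC_sub_cross_le`). WHAT THIS IS NOT: not NS; no number of record moves.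
-/

noncomputable section

namespace Summit.NavierStokesRegularity.OSWSelfSimilar
namespace SheetRSpectrumPointAssemblyA

open _root_.MeasureTheory _root_.Set _root_.Filter _root_.Real SheetRWeakProfilePV SheetRWeakToStrong SheetREnergyClass SheetRWeightedMeasure
  SheetRLinearisedTests SheetREnergySpace SheetRTestSpace SheetRLinearisedFormBounds SheetRSolutionOperator SheetRLinearisedCutoffEnergy
  SheetRResolventPair SheetRComplexPivot SheetRResolventComplex SheetRResolventIdentity SheetRPerturbedUniqueness SheetRPerturbedPair
  SheetRPerturbedResolventC SheetRPerturbedResolventIdentityC SheetROddClass SheetRResolventOddClass SheetRGeneratorOddWeak SheetREvansOdd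
  SheetREvansEnclosure SheetRSpectrumWindingLists SheetRSpectrumStepRule SheetRSpectrumPointCertificate SheetRResolventConj
  SheetRLinearisationPerturbation SheetRSpectrumOddAssembly SheetRSpectrumPointCertificateA SheetRSpectrumPointAssembly
  Literature.Analysis.OperatorTheory Literature.Analysis.Complex Complex
open scoped Topology ENNReal ComplexConjugate InnerProductSpace

variable {L D₀ D₁ V₀ c m c₁ m₁ : ℝ} {d V : ℝ → ℝ}

/-- **THE SHEET CERTIFICATE WITH THE LEFT EDGE FROM IMPLEMENTATION 1's POINT BALLS** (`PointDataA`) and the far edges from the mixed far record: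
same hypotheses as `SheetRSpectrumPointAssembly.sheet_certificate_of_pointData` with `PointData` replaced by `PointDataA`; conclusion `RectLabelCertificate E*`
(the far-field exclusion `hfar` is implementation 2's either way — take it from `sheet_certificate_of_pointData`). [folklore] -/
theorem sheet_certificate_of_pointDataA (hL : 0 < L) (K K₁ : Esp L hL →L[ℝ] W L)
    (hK : GardingDataKC L hL d V K D₀ D₁ V₀ c m) (hK₁ : GardingDataKC L hL d V K₁ D₀ D₁ V₀ c₁ m₁)
    (hm : (3 : ℝ) / 20 ≤ m) (hm₁ : -m₁ < ra)
    {hv : Wc L} {f : Wcodd L} (hh : imW L hv = 0) (hf : imW L (f : Wc L) = 0) {θ : ℂ} (hθ : ‖θ‖ ≤ 4) (hθr : θ.im = 0)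
    (hP : ‖θ‖ * (‖hv‖ * (‖K₁ - K‖ * (4 / min c (4 * (m + ra))) * ‖(f : Wc L)‖ / (m₁ + ra))) ≤ (1873 : ℝ) / 500000)
    (hPD : PointDataA (resolventKC hL K hK) hv (f : Wc L) θ
      (evansOdd hL K hK ((innerSL ℂ hv).comp (Wcodd L).subtypeL) f θ))
    (hFD : MixedFarDatum (resolventKC hL K hK) hv (f : Wc L) 1 ((3593635617 : ℝ) / 5000000000)
      ((331182857 : ℝ) / 250000000) ((802337581 : ℝ) / 500000000) ((1710547133 : ℝ) / 1000000000)) :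
    RectLabelCertificate (evansOdd hL K₁ hK₁ ((innerSL ℂ hv).comp (Wcodd L).subtypeL) f θ) := by
  set ℓ : Wcodd L →L[ℂ] ℂ := (innerSL ℂ hv).comp (Wcodd L).subtypeL with hℓ
  have hθeq : θ = ((θ.re : ℝ) : ℂ) := Complex.ext (by simp) (by simp [hθr])
  have hE : ∀ w, evansOdd hL K hK ℓ f θ w = 1 - θ * ⟪hv, resolventKC hL K hK w (f : Wc L)⟫_ℂ := fun w => by
    rw [hℓ, evansOdd_comp_subtypeL, innerSL_apply_apply]
  have hE' : ∀ w, evansOdd hL K hK ℓ f θ w = 1 - ((θ.re : ℝ) : ℂ) * ⟪hv, resolventKC hL K hK w (f : Wc L)⟫_ℂ := fun w => by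
    rw [hE, ← hθeq]
  have hE₁ : ∀ w, evansOdd hL K₁ hK₁ ℓ f θ w = 1 - θ * ⟪hv, resolventKC hL K₁ hK₁ w (f : Wc L)⟫_ℂ := fun w => by
    rw [hℓ, evansOdd_comp_subtypeL, innerSL_apply_apply]
  have hJ := isPseudoResolventKC hL K hK
  have hra : ra = -(3 : ℝ) / 100 := rfl
  have hmra : -m < ra := by rw [hra]; linarith
  have hU : ∀ w : ℂ, ra ≤ w.re → w ∈ {σ : ℂ | -m < σ.re} := fun w hw => lt_of_lt_of_le hmra hw
  have hb : ∀ w : ℂ, ra ≤ w.re → ∀ G : Wc L, ‖resolventKC hL K hK w G‖ ≤ ‖G‖ / (m + w.re) :=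
    fun w hw G => norm_resolventKC_le_inv hL K hK (hU w hw) G
  have hsym := evans_resolventKC_conj' hK hh hf θ.re hE'
  -- the (P8) allowance, uniform on `Re ≥ ra`
  have hκ₀ : 0 < min c (4 * (m + ra)) := kappaC_pos hK hmra
  have hm₁ra : 0 < m₁ + ra := by linarith
  have hpert : ∀ w : ℂ, ra ≤ w.re → ‖evansOdd hL K₁ hK₁ ℓ f θ w - evansOdd hL K hK ℓ f θ w‖ ≤
      ‖θ‖ * (‖hv‖ * (‖K₁ - K‖ * (4 / min c (4 * (m + ra))) * ‖(f : Wc L)‖ / (m₁ + ra))) := by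
    intro w hw
    have hσ : -m < w.re := hU w hw
    have hσ₁ : -m₁ < w.re := lt_of_lt_of_le hm₁ hw
    have hx := norm_inner_resolventKC_sub_cross_le hK hK₁ hσ hσ₁ hv (f : Wc L)
    rw [hE₁, hE]
    have e : (1 - θ * ⟪hv, resolventKC hL K₁ hK₁ w (f : Wc L)⟫_ℂ) - (1 - θ * ⟪hv, resolventKC hL K hK w (f : Wc L)⟫_ℂ) =
        θ * (⟪hv, resolventKC hL K hK w (f : Wc L)⟫_ℂ - ⟪hv, resolventKC hL K₁ hK₁ w (f : Wc L)⟫_ℂ) := by ring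
    rw [e, norm_mul]
    refine mul_le_mul_of_nonneg_left (hx.trans ?_) (norm_nonneg θ)
    have hmin : min c (4 * (m + ra)) ≤ min c (4 * (m + w.re)) := min_le_min le_rfl (by linarith)
    have hden : m₁ + ra ≤ m₁ + w.re := by linarith
    have h4 : 4 / min c (4 * (m + w.re)) ≤ 4 / min c (4 * (m + ra)) := div_le_div_of_nonneg_left (by norm_num) hκ₀ hmin
    have hnum : ‖K₁ - K‖ * (4 / min c (4 * (m + w.re))) * ‖(f : Wc L)‖ ≤ ‖K₁ - K‖ * (4 / min c (4 * (m + ra))) * ‖(f : Wc L)‖ := by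
      gcongr
    have hnn : 0 ≤ ‖K₁ - K‖ * (4 / min c (4 * (m + ra))) * ‖(f : Wc L)‖ := by positivity
    refine mul_le_mul_of_nonneg_left ?_ (norm_nonneg hv)
    calc ‖K₁ - K‖ * (4 / min c (4 * (m + w.re))) * ‖(f : Wc L)‖ / (m₁ + w.re)
        ≤ ‖K₁ - K‖ * (4 / min c (4 * (m + ra))) * ‖(f : Wc L)‖ / (m₁ + w.re) :=
          div_le_div_of_nonneg_right hnum (by linarith)
      _ ≤ ‖K₁ - K‖ * (4 / min c (4 * (m + ra))) * ‖(f : Wc L)‖ / (m₁ + ra) :=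
          div_le_div_of_nonneg_left hnn hm₁ra hden
  exact rectLabelCertificate_of_pointDataA hJ hU hm hb hθ hE hsym hpert hP hPD hFD


end SheetRSpectrumPointAssemblyA
end Summit.NavierStokesRegularity.OSWSelfSimilar

end
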